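import Mathlib
import Literature.Probability.LatticeModels.TorusFourierWeightedL1
import HarnessLib

/-!
# Dyadic (Bernstein) blocks for character sums on `(ℤ/Lℤ)^d`: position shells paid by COARSE symbol differences

Topic `Probability/LatticeModels`; companion of `TorusFourierWeightedL1.lean` (weighted Plancherel: a GLOBAL weight
`(4|ã_v(x)|/L)^{2N}` is paid by `N` UNIT-step differences of the symbol) and `TorusFourierWienerBound.lean` (`Σ_z |ĝ(z)|`
from first and second unit differences).  Those global-weight bounds interpolate only between the orders `0` and `N` of
the symbol's differences; for a position MOMENT `Σ_x |x̃|^s ‖g(x)‖` they force `N > s + d/2` unit differences on the whole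
torus.  Bernstein's classical proof of `C^α(𝕋^d) ⊂ A(𝕋^d)` (`α > d/2`; Zygmund VI.3, Katznelson I.6) does better: it cuts
position space into DYADIC SHELLS `S_A = {x : A ≤ |x̃|_∞ < 2A}` and, on the shell of scale `A`, differences the symbol with
the COARSE step `m(A) ≍ L/A` for which `‖χ_{m v}(x) - 1‖ ≥ 1/4` on the shell — so each shell may be paid by a DIFFERENT
order `N`, and the orders may straddle `s + d/2` (the Besov `B^{s+d/2}_{2,1}` mechanism).  In the finite, uniform-in-`L`
form of this topic (`g(x) = Σ_k χ_k(x) h(k)`, `ã_v(x) = valMinAbs (Σ_j v_j x_j)`):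

* §1 `blockStep L A` (`= ⌊L/(8A)⌋` if `16A ≤ L`, else `1`) and **`quarter_le_chord_blockStep`**: for `A ≤ |ã| < 2A`,
  `1/4 ≤ 4|valMinAbs (m(A)·a)|/L`; `two_pi_mul_blockStep_div_le`: the momentum step `2π m(A)/L ≤ π/A`;
* §2 **`sum_norm_sq_le_of_shell`** — block Plancherel: for `T ⊆ {x : A ≤ |ã_v(x)| < 2A}` and every `N`,
  `Σ_{x ∈ T} ‖g(x)‖² ≤ 16^N · L^d · Σ_k ‖(Δ_{m(A)•v}^N h)(k)‖²`;
* §3 cube shells `cubeShell A = {x : A ≤ |x̃|_∞ < 2A}` (`torusSupNorm x = max_i |x̃_i|`), `card_cubeShell_le : # ≤ (4A)^d`,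
  **`sum_cubeShell_norm_sq_le`** (the `d` axis directions cover the shell);
* (sequel `TorusFourierDyadicMoments.lean`: the weighted block `ℓ¹` bound, the dyadic cover `Σ_x = F(0) + Σ_j Σ_{S_{2^j}}`, the
  two-law summation `Σ_j min(a·2^j, b/2^j) ≤ a·2^t + 2b/2^t`, and the assembled dyadic bound.)

With sampled symbols `h(q) = K(2πq/L)` of a `C^N` function, `D ≤ (π/A)^N ‖∂_i^N K‖_∞` (§1), so a shell of scale `A` costs
`≍ W(A)·A^{d/2 - N}·‖D^N K‖_∞` for every `N`: e.g. the first moment (`s = 1`) in `d = 2` from the FIRST and THIRD derivative laws,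
`Σ_x |x̃|_∞‖L^{-2}g(x)‖ ≲ Σ_j min(2^j‖DK‖, 2^{-j}‖D³K‖) ≲ √(‖DK‖·‖D³K‖)` — never touching `‖K‖_∞` or a fourth difference
(cell gate-hubbard-kl, route (E4-b) of the KL-regime engine: first moments of the frame pieces' lattice kernels, whose typed
derivative laws `Gfr_j U² 4^{(j-2)n}` make exactly this interpolation `n`-uniform).

Everything is proved; no definitions with mathematical content beyond the two bookkeeping ones (`blockStep`, `torusSupNorm` /
`cubeShell`), no named facts.

## Sources

A. Zygmund, *Trigonometric Series* Vol. I, CUP 2002, Ch. VI §3 (Bernstein's theorem, Thm 3.1) [`Zygmund2002`];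
Y. Katznelson, *An Introduction to Harmonic Analysis*, 3rd ed., CUP 2004, Ch. I §6.3 [`Katznelson2004`];
S. Friedli, Y. Velenik, *Statistical Mechanics of Lattice Systems*, CUP 2017, §10.4 (discrete Fourier analysis on the torus)
[`FriedliVelenik2017`].
-/

noncomputable section

open Finset Complex
open scoped Real ComplexConjugate

namespace Literature.Probability.LatticeModels

variable {d L : ℕ} [NeZero L]

/-! ### §1 The coarse step of a dyadic block and its chord bound -/

/-- The COARSE dual step attached to the block scale `A`: `⌊L/(8A)⌋` when `16A ≤ L`, else `1` (Bernstein's `h ≍ 1/A`).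
[cite: Zygmund2002, Ch. VI §3 Thm 3.1] -/
def blockStep (L A : ℕ) : ℕ := if 16 * A ≤ L then L / (8 * A) else 1

omit [NeZero L] in
/-- `1 ≤ m(A)`. [cite: Zygmund2002, Ch. VI §3 (proof of Thm 3.1)] -/
theorem one_le_blockStep {A : ℕ} (hA : 0 < A) : 1 ≤ blockStep L A := by
  unfold blockStep
  split_ifs with h
  · exact (Nat.le_div_iff_mul_le (by omega)).2 (by omega)
  · exact le_rfl

omit [NeZero L] in
/-- In the small-scale case `16A ≤ L`: `m(A)·8A ≤ L`. [cite: Zygmund2002, Ch. VI §3 (proof of Thm 3.1)] -/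
theorem blockStep_mul_le {A : ℕ} (h : 16 * A ≤ L) : blockStep L A * (8 * A) ≤ L := by
  unfold blockStep
  rw [if_pos h]
  exact Nat.div_mul_le_self L (8 * A)

omit [NeZero L] in
/-- In the small-scale case `16A ≤ L`: `L < (m(A) + 1)·8A`, i.e. `L - 8A < m(A)·8A`. [cite: Zygmund2002, Ch. VI §3 (proof of Thm 3.1)] -/
theorem lt_blockStep_succ_mul {A : ℕ} (hA : 0 < A) (h : 16 * A ≤ L) : L < (blockStep L A + 1) * (8 * A) := by
  unfold blockStep
  rw [if_pos h]
  rw [add_mul, one_mul]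
  exact Nat.lt_div_mul_add (by omega)

omit [NeZero L] in
/-- In the large-scale case `L < 16A`: `m(A) = 1`. [cite: Zygmund2002, Ch. VI §3 (proof of Thm 3.1)] -/
theorem blockStep_eq_one {A : ℕ} (h : ¬ 16 * A ≤ L) : blockStep L A = 1 := by
  unfold blockStep
  rw [if_neg h]

omit [NeZero L] in
/-- **The momentum step of the block is at most `π/A`**: `2π·m(A)/L ≤ π/A` whenever `0 < A` and `2A ≤ L` (the shell of scale
`A` is empty otherwise, since `|x̃_i| ≤ L/2`). [cite: Zygmund2002, Ch. VI §3 Thm 3.1] -/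
theorem two_pi_mul_blockStep_div_le {A : ℕ} (hA : 0 < A) (hAL : 2 * A ≤ L) :
    2 * π * (blockStep L A : ℝ) / L ≤ π / A := by
  have hA' : (0 : ℝ) < A := by exact_mod_cast hA
  have hL : (0 : ℝ) < L := by exact_mod_cast (show 0 < L by omega)
  by_cases h : 16 * A ≤ L
  · have hm : (blockStep L A : ℝ) * (8 * A) ≤ L := by exact_mod_cast blockStep_mul_le h
    rw [div_le_div_iff₀ hL hA']
    nlinarith [Real.pi_pos]
  · rw [blockStep_eq_one h, Nat.cast_one, mul_one, div_le_div_iff₀ hL hA']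
    have : (2 : ℝ) * A ≤ L := by exact_mod_cast hAL
    nlinarith [Real.pi_pos]

/-- **The chord bound on a dyadic shell**: if `A ≤ |ã| < 2A` (`ã = valMinAbs a`, `0 < A`), then the coarse multiple `m(A)·a`
satisfies `1/4 ≤ 4·|valMinAbs (m(A)·a)|/L` — in the small-scale case the centred representative is LINEAR, `valMinAbs (m·a) = m·ã`
(`2m·|ã| < 4mA ≤ L/2`), and `16·m·A > 2L - 16A ≥ L`; in the large-scale case `m = 1` and `4A/L > 1/4`.
[cite: Zygmund2002, Ch. VI §3 Thm 3.1] -/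
theorem quarter_le_chord_blockStep {A : ℕ} (hA : 0 < A) (a : ZMod L) (hlo : A ≤ a.valMinAbs.natAbs)
    (hhi : a.valMinAbs.natAbs < 2 * A) :
    (1 : ℝ) / 4 ≤ 4 * |((((blockStep L A : ℕ) : ZMod L) * a).valMinAbs : ℝ)| / L := by
  have hL0 : 0 < L := Nat.pos_of_ne_zero (NeZero.ne L)
  have hL : (0 : ℝ) < L := by exact_mod_cast hL0
  set n := a.valMinAbs with hn
  have habs : (n.natAbs : ℤ) = |n| := Int.natCast_natAbs n
  by_cases h : 16 * A ≤ L
  · -- small-scale case: linearise the centred representative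
    set m := blockStep L A with hm
    have hm8 : m * (8 * A) ≤ L := blockStep_mul_le h
    have hmlt : L < (m + 1) * (8 * A) := lt_blockStep_succ_mul hA h
    have hprod : (((m : ℕ) : ZMod L) * a) = (((m : ℤ) * n : ℤ) : ZMod L) := by
      rw [hn, Int.cast_mul, Int.cast_natCast, ZMod.coe_valMinAbs]
    have hsmall : ((m : ℤ) * n) * 2 ∈ Set.Ioc (-(L : ℤ)) L := by
      have h1 : |(m : ℤ) * n| * 2 < L := by
        have : (n.natAbs : ℤ) ≤ 2 * A - 1 := by omega
        rw [abs_mul, Nat.abs_cast]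
        have hm8' : ((m * (8 * A) : ℕ) : ℤ) ≤ L := by exact_mod_cast hm8
        push_cast at hm8'
        nlinarith [abs_nonneg n, habs]
      constructor
      · nlinarith [neg_abs_le ((m : ℤ) * n), abs_nonneg ((m : ℤ) * n)]
      · nlinarith [le_abs_self ((m : ℤ) * n)]
    have hval : ((((m : ℕ) : ZMod L) * a).valMinAbs) = (m : ℤ) * n := by
      rw [hprod]
      exact (ZMod.valMinAbs_spec _ _).2 ⟨rfl, hsmall⟩
    rw [hval]
    push_cast
    rw [abs_mul, Nat.abs_cast]
    have hlo' : (A : ℝ) ≤ |(n : ℝ)| := by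
      have : ((A : ℤ) : ℝ) ≤ ((n.natAbs : ℤ) : ℝ) := by exact_mod_cast hlo
      rw [habs] at this
      simpa using this
    have hm16 : (L : ℝ) ≤ 16 * m * A := by
      have h1 : ((L : ℕ) : ℤ) < ((m + 1) * (8 * A) : ℕ) := by exact_mod_cast hmlt
      have h2 : ((16 * A : ℕ) : ℤ) ≤ L := by exact_mod_cast h
      have : (L : ℝ) < (m + 1) * (8 * A) := by exact_mod_cast hmlt
      have : (16 : ℝ) * A ≤ L := by exact_mod_cast h
      nlinarith
    rw [le_div_iff₀ hL]
    have hm0 : (0 : ℝ) ≤ m := Nat.cast_nonneg m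
    nlinarith [hlo', abs_nonneg (n : ℝ)]
  · -- large-scale case: `m = 1`
    rw [blockStep_eq_one h, Nat.cast_one, one_mul]
    have hlo' : (A : ℝ) ≤ |(n : ℝ)| := by
      have : ((A : ℤ) : ℝ) ≤ ((n.natAbs : ℤ) : ℝ) := by exact_mod_cast hlo
      rw [habs] at this
      simpa using this
    have h16 : (L : ℝ) < 16 * A := by exact_mod_cast (not_le.1 h)
    rw [le_div_iff₀ hL]
    linarith

/-! ### §2 Block Plancherel on a one-directional shell -/

omit [NeZero L] in
/-- The phase of a coarse multiple of a direction: `Σ_j (m•v)_j x_j = m · Σ_j v_j x_j`. [cite: Zygmund2002, Ch. VI §3 (proof of Thm 3.1)] -/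
theorem sum_nsmul_mul_eq (m : ℕ) (v x : TorusSite d L) : ∑ j, (m • v) j * x j = ((m : ℕ) : ZMod L) * ∑ j, v j * x j := by
  rw [mul_sum]
  refine sum_congr rfl fun j _ => ?_
  rw [Pi.smul_apply, nsmul_eq_mul, mul_assoc]

/-- **Block Plancherel**: on any part `T` of the shell `{x : A ≤ |ã_v(x)| < 2A}` of the direction `v`, and for every order `N`,
`Σ_{x ∈ T} ‖Σ_k χ_k(x) h(k)‖² ≤ 16^N · L^d · Σ_k ‖(Δ_{m(A)•v}^N h)(k)‖²` — `N` COARSE differences of the symbol (step `m(A)•v`,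
`2π m(A)/L ≤ π/A` in momentum units) pay for the shell, because `‖χ_{m(A)•v}(x) - 1‖ ≥ 1/4` there.
[cite: Zygmund2002, Ch. VI §3 Thm 3.1] -/
theorem sum_norm_sq_le_of_shell (h : TorusSite d L → ℂ) (v : TorusSite d L) {A : ℕ} (hA : 0 < A) (N : ℕ)
    (T : Finset (TorusSite d L))
    (hT : ∀ x ∈ T, A ≤ ((∑ j, v j * x j).valMinAbs).natAbs ∧ ((∑ j, v j * x j).valMinAbs).natAbs < 2 * A) :
    ∑ x ∈ T, ‖∑ k, torusChar k x * h k‖ ^ 2 ≤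
      (16 : ℝ) ^ N * ((L : ℝ) ^ d * ∑ k, ‖((fwdDiff (blockStep L A • v))^[N] h) k‖ ^ 2) := by
  set w : TorusSite d L := blockStep L A • v with hw
  have key : ∀ x ∈ T, ‖∑ k, torusChar k x * h k‖ ^ 2 ≤ (16 : ℝ) ^ N * ‖∑ k, torusChar k x * ((fwdDiff w)^[N] h) k‖ ^ 2 := by
    intro x hx
    have hid : ∑ k, torusChar k x * ((fwdDiff w)^[N] h) k = (conj (torusChar w x) - 1) ^ N * ∑ k, torusChar k x * h k := by
      have := sum_torusChar_smul_fwdDiff_iter (E := ℂ) w x N h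
      simpa only [smul_eq_mul] using this
    have hconj : ‖conj (torusChar w x) - 1‖ = ‖torusChar w x - 1‖ := by
      rw [show conj (torusChar w x) - 1 = conj (torusChar w x - 1) by rw [map_sub, map_one], Complex.norm_conj]
    have hchord : (1 : ℝ) / 4 ≤ ‖torusChar w x - 1‖ := by
      refine le_trans ?_ (le_norm_torusChar_sub_one w x)
      rw [hw, sum_nsmul_mul_eq]
      exact quarter_le_chord_blockStep hA _ (hT x hx).1 (hT x hx).2
    have hpt : (1 / 4 : ℝ) ^ N * ‖∑ k, torusChar k x * h k‖ ≤ ‖∑ k, torusChar k x * ((fwdDiff w)^[N] h) k‖ := by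
      rw [hid, norm_mul, norm_pow, hconj]
      exact mul_le_mul_of_nonneg_right (pow_le_pow_left₀ (by norm_num) hchord N) (norm_nonneg _)
    have h0 : 0 ≤ (1 / 4 : ℝ) ^ N * ‖∑ k, torusChar k x * h k‖ := by positivity
    have hsq := pow_le_pow_left₀ h0 hpt 2
    rw [mul_pow] at hsq
    have h16 : (16 : ℝ) ^ N * ((1 / 4 : ℝ) ^ N) ^ 2 = 1 := by
      rw [← pow_mul, mul_comm N 2, pow_mul, ← mul_pow]; norm_num
    calc ‖∑ k, torusChar k x * h k‖ ^ 2
        = (16 : ℝ) ^ N * (((1 / 4 : ℝ) ^ N) ^ 2 * ‖∑ k, torusChar k x * h k‖ ^ 2) := by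
          rw [← mul_assoc, h16, one_mul]
      _ ≤ (16 : ℝ) ^ N * ‖∑ k, torusChar k x * ((fwdDiff w)^[N] h) k‖ ^ 2 :=
          mul_le_mul_of_nonneg_left hsq (by positivity)
  calc ∑ x ∈ T, ‖∑ k, torusChar k x * h k‖ ^ 2
      ≤ ∑ x ∈ T, (16 : ℝ) ^ N * ‖∑ k, torusChar k x * ((fwdDiff w)^[N] h) k‖ ^ 2 := sum_le_sum key
    _ ≤ ∑ x, (16 : ℝ) ^ N * ‖∑ k, torusChar k x * ((fwdDiff w)^[N] h) k‖ ^ 2 :=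
        sum_le_univ_sum_of_nonneg fun x => by positivity
    _ = (16 : ℝ) ^ N * ((L : ℝ) ^ d * ∑ k, ‖((fwdDiff w)^[N] h) k‖ ^ 2) := by
        rw [← mul_sum, sum_norm_sq_sum_torusChar_mul]

/-! ### §3 Cube shells: the `d` axis directions cover `{A ≤ |x̃|_∞ < 2A}`, which has at most `(4A)^d` points -/

/-- The sup norm of the centred coordinates: `|x̃|_∞ = max_i |valMinAbs (x i)|` (`0` for `d = 0`). [cite: Zygmund2002, Ch. VI §3 (proof of Thm 3.1)] -/
def torusSupNorm (x : TorusSite d L) : ℕ := univ.sup fun i => (x i).valMinAbs.natAbs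

/-- The dyadic CUBE SHELL of scale `A`: `{x : A ≤ |x̃|_∞ < 2A}`. [cite: Zygmund2002, Ch. VI §3 Thm 3.1] -/
def cubeShell (d L : ℕ) [NeZero L] (A : ℕ) : Finset (TorusSite d L) :=
  univ.filter fun x => A ≤ torusSupNorm x ∧ torusSupNorm x < 2 * A

/-- Membership in the cube shell. [cite: Zygmund2002, Ch. VI §3 (proof of Thm 3.1)] -/
theorem mem_cubeShell {A : ℕ} {x : TorusSite d L} : x ∈ cubeShell d L A ↔ A ≤ torusSupNorm x ∧ torusSupNorm x < 2 * A := by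
  simp [cubeShell]

omit [NeZero L] in
/-- Every coordinate is below the sup norm. [cite: Zygmund2002, Ch. VI §3 (proof of Thm 3.1)] -/
theorem natAbs_valMinAbs_le_torusSupNorm (x : TorusSite d L) (i : Fin d) : (x i).valMinAbs.natAbs ≤ torusSupNorm x :=
  Finset.le_sup (f := fun i => (x i).valMinAbs.natAbs) (mem_univ i)

/-- A point of the shell of scale `A > 0` has a coordinate in `[A, 2A)` (and all coordinates below `2A`). [cite: Zygmund2002, Ch. VI §3 (proof of Thm 3.1)] -/
theorem exists_coord_of_mem_cubeShell {A : ℕ} (hA : 0 < A) {x : TorusSite d L} (hx : x ∈ cubeShell d L A) :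
    ∃ i : Fin d, A ≤ (x i).valMinAbs.natAbs ∧ (x i).valMinAbs.natAbs < 2 * A := by
  rw [mem_cubeShell] at hx
  obtain ⟨i, -, hi⟩ := (Finset.le_sup_iff (bot_lt_iff_ne_bot.2 (Nat.pos_iff_ne_zero.1 hA))).1 hx.1
  exact ⟨i, hi, (natAbs_valMinAbs_le_torusSupNorm x i).trans_lt hx.2⟩

/-- The sup norm is at most `L/2`. [cite: Zygmund2002, Ch. VI §3 (proof of Thm 3.1)] -/
theorem torusSupNorm_le_half (x : TorusSite d L) : torusSupNorm x ≤ L / 2 :=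
  Finset.sup_le fun i _ => ZMod.natAbs_valMinAbs_le (x i)

omit [NeZero L] in
/-- `|x̃|_∞ = 0 ↔ x = 0`. [cite: Zygmund2002, Ch. VI §3 (proof of Thm 3.1)] -/
theorem torusSupNorm_eq_zero_iff (x : TorusSite d L) : torusSupNorm x = 0 ↔ x = 0 := by
  unfold torusSupNorm
  rw [← Nat.bot_eq_zero, Finset.sup_eq_bot_iff]
  simp only [mem_univ, forall_const, Nat.bot_eq_zero, Int.natAbs_eq_zero, ZMod.valMinAbs_eq_zero]
  exact ⟨fun h => funext h, fun h i => by rw [h]; rfl⟩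

/-- **At most `4A - 1` residues have centred representative in `(-2A, 2A)`.** [cite: Zygmund2002, Ch. VI §3 (proof of Thm 3.1)] -/
theorem card_filter_natAbs_valMinAbs_lt (A : ℕ) :
    #(univ.filter fun a : ZMod L => a.valMinAbs.natAbs < 2 * A) ≤ 4 * A := by
  calc #(univ.filter fun a : ZMod L => a.valMinAbs.natAbs < 2 * A)
      ≤ #(Finset.Ioo (-(2 * A : ℤ)) (2 * A)) := by
        refine Finset.card_le_card_of_injOn ZMod.valMinAbs (fun a ha => ?_) (fun a _ b _ hab => ZMod.injective_valMinAbs hab)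
        simp only [coe_filter, mem_univ, true_and, Set.mem_setOf_eq] at ha
        simp only [coe_Ioo, Set.mem_Ioo]
        omega
    _ ≤ 4 * A := by rw [Int.card_Ioo]; omega

/-- **The cube shell of scale `A` has at most `(4A)^d` points.** [cite: Zygmund2002, Ch. VI §3 Thm 3.1] -/
theorem card_cubeShell_le (A : ℕ) : #(cubeShell d L A) ≤ (4 * A) ^ d := by
  set S : Finset (ZMod L) := univ.filter fun a : ZMod L => a.valMinAbs.natAbs < 2 * A with hS
  calc #(cubeShell d L A) ≤ #(Fintype.piFinset fun _ : Fin d => S) := by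
        refine card_le_card fun x hx => ?_
        rw [Fintype.mem_piFinset]
        intro i
        rw [hS, mem_filter]
        exact ⟨mem_univ _, (natAbs_valMinAbs_le_torusSupNorm x i).trans_lt (mem_cubeShell.1 hx).2⟩
    _ = #S ^ d := by rw [Fintype.card_piFinset, prod_const, card_univ, Fintype.card_fin]
    _ ≤ (4 * A) ^ d := Nat.pow_le_pow_left (card_filter_natAbs_valMinAbs_lt A) d

omit [NeZero L] in
/-- The phase of the axis direction `e_i` is the coordinate `x_i`. [cite: Zygmund2002, Ch. VI §3 (proof of Thm 3.1)] -/
theorem sum_single_mul_eq (i : Fin d) (x : TorusSite d L) : ∑ j, (Pi.single i (1 : ZMod L) : TorusSite d L) j * x j = x i := by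
  rw [Finset.sum_eq_single i (fun j _ hj => by rw [Pi.single_eq_of_ne hj, zero_mul]) (fun hi => absurd (mem_univ i) hi),
    Pi.single_eq_same, one_mul]

/-- **Block Plancherel for the cube shell**: for every order `N`,
`Σ_{x ∈ S_A} ‖Σ_k χ_k(x) h(k)‖² ≤ 16^N · L^d · Σ_i Σ_k ‖(Δ_{m(A) e_i}^N h)(k)‖²` (cover the shell by the `d` one-directional shells
of the axes and apply `sum_norm_sq_le_of_shell` to each). [cite: Zygmund2002, Ch. VI §3 Thm 3.1] -/
theorem sum_cubeShell_norm_sq_le (h : TorusSite d L → ℂ) {A : ℕ} (hA : 0 < A) (N : ℕ) :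
    ∑ x ∈ cubeShell d L A, ‖∑ k, torusChar k x * h k‖ ^ 2 ≤
      (16 : ℝ) ^ N * ((L : ℝ) ^ d *
        ∑ i : Fin d, ∑ k, ‖((fwdDiff (blockStep L A • (Pi.single i (1 : ZMod L) : TorusSite d L)))^[N] h) k‖ ^ 2) := by
  set F : TorusSite d L → ℝ := fun x => ‖∑ k, torusChar k x * h k‖ ^ 2 with hF
  set P : Fin d → TorusSite d L → Prop := fun i x => A ≤ (x i).valMinAbs.natAbs with hP
  -- cover with multiplicity: each shell point has an axis `i` with `A ≤ |x̃_i|`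
  have hcover : ∀ x ∈ cubeShell d L A, F x ≤ ∑ i, if P i x then F x else 0 := by
    intro x hx
    obtain ⟨i, hi, -⟩ := exists_coord_of_mem_cubeShell hA hx
    have hnn : ∀ i' ∈ (univ : Finset (Fin d)), 0 ≤ (if P i' x then F x else 0) := by
      intro i' _
      split_ifs
      · exact sq_nonneg _
      · exact le_rfl
    calc F x = if P i x then F x else 0 := by rw [if_pos hi]
      _ ≤ ∑ i', if P i' x then F x else 0 := Finset.single_le_sum (f := fun i' => if P i' x then F x else 0) hnn (mem_univ i)
  calc ∑ x ∈ cubeShell d L A, F x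
      ≤ ∑ x ∈ cubeShell d L A, ∑ i, if P i x then F x else 0 := sum_le_sum hcover
    _ = ∑ i, ∑ x ∈ (cubeShell d L A).filter (P i), F x := by
        rw [sum_comm]
        exact sum_congr rfl fun i _ => (sum_filter _ _).symm
    _ ≤ ∑ i, (16 : ℝ) ^ N * ((L : ℝ) ^ d *
          ∑ k, ‖((fwdDiff (blockStep L A • (Pi.single i (1 : ZMod L) : TorusSite d L)))^[N] h) k‖ ^ 2) := by
        refine sum_le_sum fun i _ => sum_norm_sq_le_of_shell h _ hA N _ fun x hx => ?_
        rw [mem_filter] at hx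
        rw [sum_single_mul_eq]
        exact ⟨hx.2, (natAbs_valMinAbs_le_torusSupNorm x i).trans_lt (mem_cubeShell.1 hx.1).2⟩
    _ = _ := by rw [← mul_sum, ← mul_sum]

end Literature.Probability.LatticeModels

end
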